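import Literature.AlgebraicGeometry.HodgeTheory.LimitMixedHodgeStructureNMorphism
import Literature.AlgebraicGeometry.Motives.MixedHodgeStructureAbelian
import HarnessLib

/-!
# `Ker N`, `Im N` and `Coker N` of a limit mixed Hodge structure are mixed Hodge structures

For a limit mixed Hodge structure `L = (W, F, N)` (`LimitMixedHodgeStructure.lean`; Schmid /
Morrison §5, THEOREM: "`N : H^m_lim → H^m_lim` is a morphism of mixed Hodge structures of type
`(-1, -1)`", the tree's `LimitMixedHodgeStructure.NHom : L → L(-1)`), the kernel, image and cokernel
of `N` (and of `N^a`) carry mixed Hodge structures with the induced resp. quotient filtrations —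
Morrison, *The Clemens–Schmid exact sequence and applications*, §2 PROPOSITION ("Let `K = Ker N`,
`Gr_k(K) = (W_k ∩ K)/(W_{k-1} ∩ K)` …") and §5, where every term of the Clemens–Schmid sequence
"actually underlies a mixed Hodge structure"; this is the case `f = N` of Cattani–El Zein–Griffiths–Lê,
Lemma 3.2.20 (kernels and cokernels of morphisms of MHS), formalized in
`Motives/MixedHodgeStructureAbelian.lean` (`Hom.ker`, `SubMixedHodgeStructure.ofCompatible`,
`SubMixedHodgeStructure.quotient`). Since `N` lands in the Tate twist `L(-1)`, the image is first
obtained as a sub-MHS of `L(-1)`; twisting does not change Deligne's splitting up to re-indexing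
(`MixedHodgeStructure.deligneI_tateTwist`), so `Im N` is also a sub-MHS of `L` itself and
`Coker N = V / Im N` a quotient MHS of `L` (these are the structures appearing in the Clemens–Schmid
sequence).

## Main results (all proved; no named facts)

* `MixedHodgeStructure.iSup_inf_deligneFamily_tateTwist` — compatibility with `⊕ I^{p,q}` is
  invariant under Tate twists.
* `LimitMixedHodgeStructure.kerN`, `kerPowN a` — `Ker N`, `Ker N^a` as sub-MHS of `L`;
  `rangeN`, `rangePowN a` — `Im N`, `Im N^a` as sub-MHS of `L`; `cokerN`, `cokerPowN a` — the
  quotient MHS on `V / Im N`, `V / Im N^a`; `isQuotientMHS_range_N`.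
* `kerN_W_eq_top` — `W_k(Ker N) = Ker N` (invariant classes have weight `≤ k`: Morrison §3, Cor. 1
  with `ker N ⊆ W_k`); `cokerN_W_eq_bot` — `W_{k-1}(Coker N) = 0` (`W_{k-1} ⊆ Im N`).

## References

* [Morrison1984ClemensSchmid] D. R. Morrison, *The Clemens–Schmid exact sequence and applications*,
  in: Topics in Transcendental Algebraic Geometry, Ann. of Math. Stud. 106 (1984): §2 PROPOSITION
  (p. 107), §3 (pp. 107–109), §5 THEOREM (Schmid) and CLEMENS–SCHMID II (pp. 116–117).
* [CattaniElZeinGriffithsLe2014] E. Cattani et al. (eds.), *Hodge Theory* (2014): Lemma 3.2.20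
  (p. 161), Thm. 5.3.6, Def. 7.5.9.
-/

noncomputable section

open scoped TensorProduct

namespace Literature.AlgebraicGeometry.Motives.MixedHodgeStructure

universe u

variable {V : Type u} [AddCommGroup V] [Module ℚ V]

/-- **Compatibility with Deligne's splitting is invariant under Tate twists**:
`Σ_{p,q} (U ∩ I^{p,q}(H(j))) = Σ_{p,q} (U ∩ I^{p,q}(H))`, since `I^{p,q}(H(j)) = I^{p+j,q+j}(H)`
(Cattani et al., Ex. 3.2.23 (4) with Prop. 3.2.19). [cite: CattaniElZeinGriffithsLe2014, Prop. 3.2.19] -/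
theorem iSup_inf_deligneFamily_tateTwist (H : MixedHodgeStructure V) (j : ℤ)
    (U : Submodule ℂ (ℂ ⊗[ℚ] V)) :
    ⨆ pq : ℤ × ℤ, U ⊓ (H.tateTwist j).deligneFamily pq = ⨆ pq : ℤ × ℤ, U ⊓ H.deligneFamily pq :=
  Equiv.iSup_congr ((Equiv.addRight j).prodCongr (Equiv.addRight j)) fun pq => by
    simp only [deligneFamily_apply, Equiv.prodCongr_apply, Prod.map_fst, Prod.map_snd,
      Equiv.coe_addRight, deligneI_tateTwist]

end Literature.AlgebraicGeometry.Motives.MixedHodgeStructure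

namespace Literature.AlgebraicGeometry.HodgeTheory

universe u

namespace LimitMixedHodgeStructure

open Motives Motives.MixedHodgeStructure

variable {V : Type u} [AddCommGroup V] [Module ℚ V] {k : ℤ}

/-! ### Kernels -/

/-- **`Ker N` is a sub-mixed Hodge structure of `L`** (induced filtrations `W_i ∩ Ker N`,
`F^p ∩ (Ker N)_ℂ`): the kernel of the morphism of MHS `N : L → L(-1)` (Morrison §2 PROPOSITION,
`K = Ker N` with `Gr_k(K) = (W_k ∩ K)/(W_{k-1} ∩ K)`; §5 THEOREM (Schmid); Cattani et al.,
Lemma 3.2.20). [cite: Morrison1984ClemensSchmid, §2 Proposition, p. 107; §5 Theorem (Schmid), p. 116] -/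
def kerN (L : LimitMixedHodgeStructure V k) : SubMixedHodgeStructure L.toMixedHodgeStructure :=
  L.NHom.ker

/-- The underlying subspace of `L.kerN` is `Ker N`. [cite: Morrison1984ClemensSchmid, §2 Proposition, p. 107] -/
@[simp]
theorem kerN_toSubmodule (L : LimitMixedHodgeStructure V k) :
    L.kerN.toSubmodule = LinearMap.ker L.N := rfl

/-- **`Ker N^a` is a sub-mixed Hodge structure of `L`**: the kernel of the morphism `N^a : L → L(-a)`
(Cattani et al., Lemma 3.2.20). [cite: CattaniElZeinGriffithsLe2014, Lemma 3.2.20] -/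
def kerPowN (L : LimitMixedHodgeStructure V k) (a : ℕ) :
    SubMixedHodgeStructure L.toMixedHodgeStructure :=
  (L.powNHom a).ker

/-- The underlying subspace of `L.kerPowN a` is `Ker N^a`. [cite: CattaniElZeinGriffithsLe2014, Lemma 3.2.20] -/
@[simp]
theorem kerPowN_toSubmodule (L : LimitMixedHodgeStructure V k) (a : ℕ) :
    (L.kerPowN a).toSubmodule = LinearMap.ker (L.N ^ a) := rfl

/-- **`W_k(Ker N) = Ker N`**: the induced weight filtration of `Ker N` is everything from step `k` on
(`Ker N ⊆ W_k`: the invariant classes have weight `≤ k`; Morrison §3, Cor. 1 / §2 (6)).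
[cite: Morrison1984ClemensSchmid, §3 Corollary 1, p. 108] -/
theorem kerN_W_eq_top (L : LimitMixedHodgeStructure V k) {i : ℤ} (hi : k ≤ i) :
    L.kerN.toMixedHodgeStructure.W i = ⊤ := by
  change (L.W i).comap (LinearMap.ker L.N).subtype = ⊤
  rw [Submodule.comap_subtype_eq_top]
  exact L.ker_N_le_W.trans (L.monotone_W hi)

/-! ### Images and cokernels -/

/-- **`Im N` is compatible with Deligne's splitting of `L`**: `(Im N)_ℂ ⊆ Σ ((Im N)_ℂ ∩ I^{p,q}(L))`
(the image of the morphism `N : L → L(-1)` is compatible with the splitting of `L(-1)`, which is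
that of `L` re-indexed). [cite: CattaniElZeinGriffithsLe2014, Lemma 3.2.20] -/
theorem range_N_baseChange_le_iSup_inf (L : LimitMixedHodgeStructure V k) :
    (LinearMap.range L.N).baseChange ℂ ≤
      ⨆ pq : ℤ × ℤ, (LinearMap.range L.N).baseChange ℂ ⊓ L.toMixedHodgeStructure.deligneFamily pq := by
  have h := L.NHom.range_baseChange_le_iSup_inf
  rwa [NHom_toLinearMap, iSup_inf_deligneFamily_tateTwist] at h

/-- `Im N^a` is compatible with Deligne's splitting of `L`. [cite: CattaniElZeinGriffithsLe2014, Lemma 3.2.20] -/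
theorem range_pow_N_baseChange_le_iSup_inf (L : LimitMixedHodgeStructure V k) (a : ℕ) :
    (LinearMap.range (L.N ^ a)).baseChange ℂ ≤
      ⨆ pq : ℤ × ℤ, (LinearMap.range (L.N ^ a)).baseChange ℂ ⊓
        L.toMixedHodgeStructure.deligneFamily pq := by
  have h := (L.powNHom a).range_baseChange_le_iSup_inf
  rwa [powNHom_toLinearMap, iSup_inf_deligneFamily_tateTwist] at h

/-- **`Im N` is a sub-mixed Hodge structure of `L`** (induced filtrations; the image term of the
Clemens–Schmid sequence — Morrison §5: every term "actually underlies a mixed Hodge structure";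
Cattani et al., Lemma 3.2.20). [cite: Morrison1984ClemensSchmid, §5, p. 116] -/
def rangeN (L : LimitMixedHodgeStructure V k) : SubMixedHodgeStructure L.toMixedHodgeStructure :=
  SubMixedHodgeStructure.ofCompatible _ (LinearMap.range L.N) L.range_N_baseChange_le_iSup_inf

/-- The underlying subspace of `L.rangeN` is `Im N`. [cite: Morrison1984ClemensSchmid, §5, p. 116] -/
@[simp]
theorem rangeN_toSubmodule (L : LimitMixedHodgeStructure V k) :
    L.rangeN.toSubmodule = LinearMap.range L.N := rfl

/-- `Im N^a` is a sub-mixed Hodge structure of `L`. [cite: CattaniElZeinGriffithsLe2014, Lemma 3.2.20] -/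
def rangePowN (L : LimitMixedHodgeStructure V k) (a : ℕ) :
    SubMixedHodgeStructure L.toMixedHodgeStructure :=
  SubMixedHodgeStructure.ofCompatible _ (LinearMap.range (L.N ^ a))
    (L.range_pow_N_baseChange_le_iSup_inf a)

/-- The underlying subspace of `L.rangePowN a` is `Im N^a`. [cite: CattaniElZeinGriffithsLe2014, Lemma 3.2.20] -/
@[simp]
theorem rangePowN_toSubmodule (L : LimitMixedHodgeStructure V k) (a : ℕ) :
    (L.rangePowN a).toSubmodule = LinearMap.range (L.N ^ a) := rfl

/-- **The quotient filtrations on `Coker N = V / Im N` form a mixed Hodge structure** (the tree's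
condition `IsQuotientMHS` for `Im N ⊆ V`; Morrison §2 (7) / §5; Cattani et al., Lemma 3.2.20,
cokernel case). [cite: CattaniElZeinGriffithsLe2014, Lemma 3.2.20] -/
theorem isQuotientMHS_range_N (L : LimitMixedHodgeStructure V k) :
    L.toMixedHodgeStructure.IsQuotientMHS (LinearMap.range L.N) :=
  L.rangeN.isQuotientMHS

/-- **`Coker N = V / Im N` as a mixed Hodge structure** (quotient filtrations; the cokernel term
of the Clemens–Schmid sequence `… → H^m_lim →ᴺ H^m_lim → H_{2n-m} → …`, Morrison §3/§5).
[cite: Morrison1984ClemensSchmid, §5, p. 116] -/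
def cokerN (L : LimitMixedHodgeStructure V k) : MixedHodgeStructure (V ⧸ LinearMap.range L.N) :=
  L.rangeN.quotient

/-- `Coker N^a = V / Im N^a` as a mixed Hodge structure. [cite: CattaniElZeinGriffithsLe2014, Lemma 3.2.20] -/
def cokerPowN (L : LimitMixedHodgeStructure V k) (a : ℕ) :
    MixedHodgeStructure (V ⧸ LinearMap.range (L.N ^ a)) :=
  (L.rangePowN a).quotient

/-- The weight filtration of `Coker N` is the image of `W`. [cite: Morrison1984ClemensSchmid, §5, p. 116] -/
@[simp]
theorem cokerN_W (L : LimitMixedHodgeStructure V k) (i : ℤ) :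
    L.cokerN.W i = (L.W i).map (LinearMap.range L.N).mkQ := rfl

/-- The Hodge filtration of `Coker N` is the image of `F`. [cite: Morrison1984ClemensSchmid, §5, p. 116] -/
@[simp]
theorem cokerN_F (L : LimitMixedHodgeStructure V k) (p : ℤ) :
    L.cokerN.F p = (L.F p).map ((LinearMap.range L.N).mkQ.baseChange ℂ) := rfl

/-- **`W_{k-1}(Coker N) = 0`**: the cokernel of `N` has weights `≥ k` (`W_{k-1} ⊆ Im N`,
Morrison §2, PROPOSITION (2)–(3)). [cite: Morrison1984ClemensSchmid, §2 Proposition, p. 107] -/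
theorem cokerN_W_eq_bot (L : LimitMixedHodgeStructure V k) {i : ℤ} (hi : i ≤ k - 1) :
    L.cokerN.W i = ⊥ := by
  rw [cokerN_W, eq_bot_iff, Submodule.map_le_iff_le_comap, Submodule.comap_bot, Submodule.ker_mkQ]
  exact (L.monotone_W hi).trans L.W_pred_le_range_N

/-- The projection `L → Coker N` is a morphism of MHS. [cite: Morrison1984ClemensSchmid, §5, p. 116] -/
def cokerNMkQ (L : LimitMixedHodgeStructure V k) : MixedHodgeStructure.Hom L.toMixedHodgeStructure L.cokerN :=
  L.rangeN.mkQ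

/-- `(L → Coker N) ∘ N = 0`. [cite: Morrison1984ClemensSchmid, §5, p. 116] -/
theorem cokerNMkQ_comp_N (L : LimitMixedHodgeStructure V k) :
    L.cokerNMkQ.toLinearMap ∘ₗ L.N = 0 := by
  ext x
  exact (Submodule.Quotient.mk_eq_zero _).2 (LinearMap.mem_range_self _ x)

end LimitMixedHodgeStructure

end Literature.AlgebraicGeometry.HodgeTheory

end
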